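import Summits.BirchSwinnertonDyer.BirchSwinnertonDyer.Theorems.RamifiedHeegnerPairLeafSigmaStarTightData
import Summits.BirchSwinnertonDyer.Rank1Residual.X11b.RingClassFieldNoTorsion
import HarnessLib

/-!
# Σ★″ (`LeafSigmaStarDivisibilityAtThreeOptimalOffRows`, item 27493) — NEGATIVE lemmas: the `n = 1` threshold is the
# `3`-adic Heegner index (McCallum Lemma 5.1); the strengthening «budget + 1» is false at `n = 1` modulo the per-row
# index hypothesis, which BSD₃ of the pair gives on rows with `Ш(E/K)[3] = 0`
# (standing disprover cdisprove-27493 g0; `--supports stmt-BirchSwinnertonDyer-27493`; BSD is proved or disproved for no curve)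

WHAT IS PROVED (theorems only — no definition, no named fact, no `sorry`; CONDITIONAL on the displayed named
facts / hypotheses; nothing is asserted about any curve):
* `pDiv_one_iff_le_padicValNat_index_of_noTorsion` / `pDiv_one_iff_le_padicValNat_index` — McCallum's Lemma 5.1
  at `n = 1` in index language: for `P ∈ E(K)` non-torsion mapping to `P_1`, `rank E(K) = 1`, no `3`-torsion in
  `E(K)` and no `3`-power torsion in `E(K[1])` (both from `ρ̄_{E,3}` onto): `PDiv d₁ 3 s' ↔ s' ≤ ord₃ [E(K):ℤP]`.
* `not_pDiv_one_succ_of_padicValNat_index_le` — the U₁ lead's `disprover-wanted` (rhp-p2 g52): `ord₃ [E(K):ℤP] ≤ B`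
  ⟹ `¬ PDiv d₁ 3 (B + 1)`; at `B = ord₃ ∏c_ℓ + v₃|c|` this kills «`PDiv d 3 (T + v₃ c + 1)` at `n = 1`» modulo the
  named per-row hypothesis `ord₃ [E(K):ℤP] ≤ T + v₃ c`.
* `budget_le_padicValNat_index_of_leafSigmaStar` — the `n = 1` CONTENT of Σ★″: Σ★″ ⟹ at every onto frame
  `ord₃ ∏c_ℓ(E) + v₃|c| ≤ ord₃ [E(K):ℤ y_K]` (Tamagawa–Manin divisibility of the Heegner index; BSD-predicted,
  open at an additive `3`).
* `leafSigmaStar_budget_succ_false_of_frame_index_le` — Σ★″ with budget `+ 1` (text otherwise VERBATIM) is FALSE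
  as soon as one onto Σ★″-frame has `ord₃ [E(K):ℤP] ≤ ord₃ ∏c_ℓ + v₃|c|` (displayed `∃`-hypothesis).
* `padicValNat_index_le_budget_of_bsdp_pair_of_not_dvd_sha` — that per-row hypothesis from `BSD₃(E) ∧ BSD₃(E^{d_K})`
  and `3 ∤ #Ш(E/K)` (rank-one orientation; SOED `indexBounds_of_bsdp_of_partner_bsdp`, lower component).
* `pDiv_one_iff_of_bsdp_pair` — exact picture under the two BSD₃'s on a tower-onto row:
  `PDiv d₁ 3 s' ↔ 2 s' ≤ ord₃ #Ш(E/K) + 2 ord₃ ∏c_ℓ + 2 v₃|c|`; so at `n = 1` Σ★″ asks nothing beyond BSD and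
  «budget + 1» holds iff `3 ∣ #Ш(E/K)`: the registered budget is the largest ROW-UNIFORM one.
(The `…_of_irreducible` forms — the 98 non-onto leaf classes — are the sibling file `IndexThresholdIrreducible.lean`.)
References: [McCallumLMS1991] §5 Lemma 5.1; [GrossLMS1991] §4, Lemma 4.3; [GrossZagier1986] I.(6.3), V.(2.2);
[JetchevSkinnerWan2017] §7.4.1; [Jetchev2008] Thm. 1.1, Conj. 1.3.
-/

-- D-0017: single-problem summit, so `Summit.BirchSwinnertonDyer.BirchSwinnertonDyer.…` repeats a namespace BY DESIGN.
set_option linter.dupNamespace false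
set_option autoImplicit false

noncomputable section

open scoped Classical NumberField

open WeierstrassCurve NumberField IsDedekindDomain Literature Literature.NumberTheory.EllipticCurves
  Literature.NumberTheory.EllipticCurves.ModularForms
  Literature.NumberTheory.EllipticCurves.Rank1Residual
  Literature.NumberTheory.EllipticCurves.Rank1Residual.Typed
  Summit.BirchSwinnertonDyer.Rank1Residual
  Summit.BirchSwinnertonDyer.Rank1Residual.Additive
  Summit.BirchSwinnertonDyer.Rank1Residual.X11b
  Summit.BirchSwinnertonDyer.BirchSwinnertonDyer.Theses.RamifiedHeegnerPair
  Summit.BirchSwinnertonDyer.BirchSwinnertonDyer.Theorems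

namespace Summit.BirchSwinnertonDyer.BirchSwinnertonDyer.Theorems.LeafSigmaStarDivisibilityAtThreeOptimalOffRowsNegative

section Tight

variable {K : Type} [Field K] [NumberField K]
variable {N : ℕ} [NeZero N] {W : WeierstrassCurve ℚ} [W.IsElliptic] {Dt : ModularParametrizationData W N} {β : ℤ}
  {ι : K →+* ℂ}

/-- **`3^{s'} ∣ P` in `E(K)` iff `s' ≤ M₀`**, where `3^{M₀} ∥ P` (`hx₀`, `hmax`). Pure group theory.
[cite: McCallumLMS1991, §5 Lemma 5.1 (p. 303), M₀] -/
theorem exists_zsmul_eq_iff_le {A : Type*} [AddCommGroup A] {P x₀ : A} {M₀ : ℕ} (hx₀ : 3 ^ M₀ • x₀ = P)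
    (hmax : ∀ Q : A, 3 ^ (M₀ + 1) • Q ≠ P) (s' : ℕ) :
    (∃ Q : A, ((3 ^ s' : ℕ) : ℤ) • Q = P) ↔ s' ≤ M₀ := by
  constructor
  · rintro ⟨Q, hQ⟩
    by_contra hlt
    obtain ⟨e, rfl⟩ : ∃ e, s' = M₀ + 1 + e := ⟨s' - (M₀ + 1), by omega⟩
    refine hmax (3 ^ e • Q) ?_
    rw [natCast_zsmul] at hQ
    rw [← mul_nsmul', ← pow_add]
    exact hQ
  · intro hle
    obtain ⟨e, rfl⟩ : ∃ e, M₀ = s' + e := ⟨M₀ - s', by omega⟩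
    refine ⟨3 ^ e • x₀, ?_⟩
    rw [natCast_zsmul, ← mul_nsmul', ← pow_add]
    exact hx₀

/-- **McCallum's Lemma 5.1 at `n = 1`, index form, IMAGE-FREE: `3^{s'} ∣ P_1` in `E(K[1])` iff
`s' ≤ ord₃ [E(K) : ℤP]`.** Hypotheses: `K` imaginary quadratic; `E(K)[3] = 0` (`hiv`) and `E(K[1])` has
no `3`-power torsion (`htor`) — both supplied by `ρ̄_{E,3}` onto (`pDiv_one_iff_le_padicValNat_index`), and
on the non-onto leaf rows by irreducibility + Weil pairing + `3` unramified in `K`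
(`torsionBy_pow_ringClassField_eq_bot_of_hasIrreducibleModPGaloisRep`); `rank E(K) = 1`; `P ∈ E(K)`
non-torsion mapping to `P_1 = d₁.derivedPoint`. Then `PDiv d₁ 3 s'` ⟺ `3^{s'} ∣ P` in `E(K)` (Galois
descent, tree `Three.Koly.pDiv_one_iff_exists_zsmul_eq`) ⟺ `s' ≤ M₀` (`3^{M₀} ∥ P`) ⟺ `s' ≤ ord₃ [E(K):ℤP]`
(`padicValNat_index_zmultiples_eq_of_divisibility`). So the `n = 1` layer of any Σ-form statement is
EXACTLY a lower bound on the `3`-adic Heegner index. Unconditional given the displayed hypotheses.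
[cite: McCallumLMS1991, §5 Lemma 5.1 (p. 303) and its proof (p. 304)] [cite: GrossLMS1991, Lemma 4.3] -/
theorem pDiv_one_iff_le_padicValNat_index_of_noTorsion (hK : IsImaginaryQuadratic K)
    (hiv : ∀ x : (W.baseChange K).toAffine.Point, (3 : ℕ) • x = 0 → x = 0)
    (htor : ∀ (M : ℕ) (R : (W.baseChange (ringClassField K ι 1)).toAffine.Point), ((3 ^ M : ℕ) : ℤ) • R = 0 → R = 0)
    (hrank : (W.baseChange K).mordellWeilRank = 1) (d₁ : KolyvaginHeegnerData Dt β ι 1)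
    (P : (W.baseChange K).toAffine.Point)
    (hP1 : WeierstrassCurve.Affine.Point.map (W' := W) (algebraMap K (ringClassField K ι 1)).toRatAlgHom P =
      d₁.derivedPoint)
    (hPinf : ¬ IsOfFinAddOrder P) (s' : ℕ) :
    Three.Koly.PDiv d₁ 3 s' ↔ s' ≤ padicValNat 3 (AddSubgroup.zmultiples P).index := by
  -- `3^{M₀} ∥ P` in `E(K)` and `ord₃ [E(K):ℤP] = M₀`
  haveI : Module.Finite ℤ (W.baseChange K).toAffine.Point := (W.baseChange K).module_finite_point_holds
  obtain ⟨M₀, x₀, hx₀, hmax⟩ := exists_pow_smul_eq_and_forall_ne hPinf (p := 3) Nat.prime_three.two_le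
  have hdiv : ∃ Q : (W.baseChange K).toAffine.Point, ((3 ^ M₀ : ℕ) : ℤ) • Q = P :=
    ⟨x₀, by rw [natCast_zsmul]; exact hx₀⟩
  have hndiv : ¬ ∃ Q : (W.baseChange K).toAffine.Point, ((3 ^ (M₀ + 1) : ℕ) : ℤ) • Q = P := by
    rintro ⟨Q, hQ⟩
    exact hmax Q (by rw [← natCast_zsmul]; exact hQ)
  haveI : Finite (AddCommGroup.torsion (W.baseChange K).toAffine.Point) :=
    WeierstrassCurve.finite_torsion_point (W := W.baseChange K)
  obtain ⟨c, Q, hcQ, hcker⟩ := RankOne.exists_coord_of_mordellWeilRank_eq_one (W.baseChange K) hrank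
  have hidx : padicValNat 3 (AddSubgroup.zmultiples P).index = M₀ :=
    Three.Koly.padicValNat_index_zmultiples_eq_of_divisibility c Q hcQ hcker hiv P hdiv hndiv
  -- Galois descent
  rw [Three.Koly.pDiv_one_iff_exists_zsmul_eq hK d₁ P hP1 3 s' (htor s'), hidx]
  exact exists_zsmul_eq_iff_le hx₀ hmax s'

/-- **McCallum's Lemma 5.1 at `n = 1`, index form, on a `ρ̄_{E,3}`-onto row:** `PDiv d₁ 3 s' ↔
s' ≤ ord₃ [E(K):ℤP]`. `ρ̄_{E,3}` onto gives `E(K)[3] = 0`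
(`torsionBy_eq_bot_of_isImaginaryQuadratic_of_hasIrreducibleModPGaloisRep`) and no `3`-power torsion in
`E(K[1])` (Gross Lemma 4.3, tree `RingClassNoTorsion.eq_zero_of_zsmul_pow_eq_zero_ringClassField`).
[cite: McCallumLMS1991, §5 Lemma 5.1 (p. 303)] [cite: GrossLMS1991, Lemma 4.3] -/
theorem pDiv_one_iff_le_padicValNat_index (hK : IsImaginaryQuadratic K) (hsurj3 : W.HasSurjectiveModNGaloisRep 3)
    (hrank : (W.baseChange K).mordellWeilRank = 1) (d₁ : KolyvaginHeegnerData Dt β ι 1)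
    (P : (W.baseChange K).toAffine.Point)
    (hP1 : WeierstrassCurve.Affine.Point.map (W' := W) (algebraMap K (ringClassField K ι 1)).toRatAlgHom P =
      d₁.derivedPoint)
    (hPinf : ¬ IsOfFinAddOrder P) (s' : ℕ) :
    Three.Koly.PDiv d₁ 3 s' ↔ s' ≤ padicValNat 3 (AddSubgroup.zmultiples P).index := by
  have hp2 : (3 : ℕ) ≠ 2 := by decide
  have hirr : W.HasIrreducibleModPGaloisRep 3 := hasIrreducibleModPGaloisRep_of_hasSurjectiveModNGaloisRep W 3 hsurj3
  -- `E(K)[3] = 0`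
  have hbot := torsionBy_eq_bot_of_isImaginaryQuadratic_of_hasIrreducibleModPGaloisRep W K hK Nat.prime_three hirr
  have hiv : ∀ x : (W.baseChange K).toAffine.Point, (3 : ℕ) • x = 0 → x = 0 := fun x hx ↦ by
    have hmem : x ∈ AddSubgroup.torsionBy (W.baseChange K).toAffine.Point (((3 : ℕ) : ℕ) : ℤ) := by
      rw [mem_torsionBy_iff, natCast_zsmul]
      exact hx
    rw [hbot] at hmem
    exact hmem
  exact pDiv_one_iff_le_padicValNat_index_of_noTorsion hK hiv
    (fun M R hR ↦ RingClassNoTorsion.eq_zero_of_zsmul_pow_eq_zero_ringClassField W hK ι one_ne_zero Nat.prime_three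
      hp2 hsurj3 M R hR) hrank d₁ P hP1 hPinf s'

/-- **The strengthening by one fails at `n = 1` modulo the per-row index hypothesis** (the lead's
`disprover-wanted`, rhp-p2 g52): if `ord₃ [E(K):ℤP] ≤ B` then `¬ 3^{B+1} ∣ P_1`, i.e.
`¬ PDiv d₁ 3 (B + 1)`; with `B = ord₃ ∏c_ℓ(E) + v₃|c|` this is `¬ PDiv d₁ 3 (T + v₃ c + 1)`. The
hypothesis is the `3`-part of the Gross–Zagier/BSD index identity on a row with `Ш(E/K)[3] = 0`
(`padicValNat_index_le_budget_of_bsdp_pair_of_not_dvd_sha`) and is an EXACT per-pair computation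
(index coefficient `n′` of `2y_K = n′Q′ + T`, engine `heeg2.gp` of QP1-E1-HEEGNER-INDEX-PROTO-v1).
[cite: McCallumLMS1991, §5 Lemma 5.1 (p. 303)] -/
theorem not_pDiv_one_succ_of_padicValNat_index_le (hK : IsImaginaryQuadratic K)
    (hsurj3 : W.HasSurjectiveModNGaloisRep 3) (hrank : (W.baseChange K).mordellWeilRank = 1)
    (d₁ : KolyvaginHeegnerData Dt β ι 1) (P : (W.baseChange K).toAffine.Point)
    (hP1 : WeierstrassCurve.Affine.Point.map (W' := W) (algebraMap K (ringClassField K ι 1)).toRatAlgHom P =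
      d₁.derivedPoint)
    (hPinf : ¬ IsOfFinAddOrder P) {B : ℕ} (hidx : padicValNat 3 (AddSubgroup.zmultiples P).index ≤ B) :
    ¬ Three.Koly.PDiv d₁ 3 (B + 1) := by
  rw [pDiv_one_iff_le_padicValNat_index hK hsurj3 hrank d₁ P hP1 hPinf]
  omega

/-- **From the frame binders of Σ★″ to the descent binders.** At a Σ★″-frame with `P` non-torsion,
Shimura reciprocity (`hrec`) identifies `P_1` with the image of `P` in `E(K[1])`
(`heegnerSystem_exists_isHeegnerPoint_map_eq_derivedPoint_one` + `eq_of_map_eq_heegnerPointComplex`), and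
Kolyvagin's theorem (`hKo`, named) gives `rank E(K) = 1`. CONDITIONAL on `hrec`, `hKo`. [folklore] -/
theorem map_eq_derivedPoint_and_rank_of_frame [W.IsGloballyMinimal]
    (hrec : heegnerPointOfConductor_one_galoisConj N W K) (hKo : kolyvagin N W K)
    (hK : IsImaginaryQuadratic K) (hHN : SatisfiesHeegnerHypothesis N K) {H : HeegnerDatum N (NumberField.discr K)}
    {P : (W.baseChange K).toAffine.Point}
    (hP : WeierstrassCurve.Affine.Point.map (W' := W) ι.toRatAlgHom P = heegnerPointComplex Dt H)
    (hPinf : ¬ IsOfFinAddOrder P) (d₁ : KolyvaginHeegnerData Dt H.β ι 1) :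
    WeierstrassCurve.Affine.Point.map (W' := W) (algebraMap K (ringClassField K ι 1)).toRatAlgHom P =
        d₁.derivedPoint ∧ (W.baseChange K).mordellWeilRank = 1 := by
  obtain ⟨P₀, -, hP₀⟩ := heegnerSystem_exists_isHeegnerPoint_map_eq_derivedPoint_one hrec hK hHN d₁
  obtain rfl : P₀ = P := KolyvaginBottom.eq_of_map_eq_heegnerPointComplex hrec hK hHN d₁ rfl hP hP₀
  exact ⟨hP₀, (hKo hK hHN ⟨Dt, H, ι, hP⟩ hPinf).1⟩

/-- **The `n = 1` content of Σ★″ is the Tamagawa–Manin divisibility of the Heegner index.** If Σ★″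
holds then at every Σ★″-frame whose curve has `ρ̄_{E,3}` onto and for which a conductor-`1` datum exists
(Darmon Thm. 3.6, `h36`): `ord₃ ∏c_ℓ(E) + v₃|c| ≤ ord₃ [E(K) : ℤ y_K]`. (Take `s' =` budget, `n = 1`.)
This inequality is the UPPER half of the `3`-part of the Gross–Zagier–BSD index identity with the
`Ш`-term dropped; it follows from `BSD₃(E) ∧ BSD₃(E^{d_K})` (SOED `indexBounds_of_bsdp_of_partner_bsdp`,
upper component) and is not known otherwise at an additive `3` (Jetchev 2008 Thm. 1.1 proves the
analogous index divisibility only for `p ∤ N`). A necessary condition, not a refutation.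
CONDITIONAL on `hrec`, `hKo`, `h36`. [cite: McCallumLMS1991, §5 Lemma 5.1 (p. 303)]
[cite: Jetchev2008, Thm. 1.1 and Conj. 1.3] [cite: GrossZagier1986, V.(2.2)] -/
theorem budget_le_padicValNat_index_of_leafSigmaStar (hS : LeafSigmaStarDivisibilityAtThreeOptimalOffRows)
    (hrec : ∀ (N : ℕ) [NeZero N] (W : WeierstrassCurve ℚ) (K : Type) [Field K] [NumberField K],
      heegnerPointOfConductor_one_galoisConj N W K)
    (hKo : ∀ (N : ℕ) [NeZero N] (W : WeierstrassCurve ℚ) (K : Type) [Field K] [NumberField K],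
      kolyvagin N W K)
    (h36 : ∀ (N : ℕ) [NeZero N] (W : WeierstrassCurve ℚ) (K : Type) [Field K] [NumberField K],
      phi_heegnerTau_mem_range_map_singularModuliField N W K)
    (W : WeierstrassCurve ℚ) [W.IsElliptic] [W.IsGloballyMinimal] (N : ℕ) [NeZero N]
    (K : Type) [Field K] [NumberField K]
    (Dt : ModularParametrizationData W N) (H : HeegnerDatum N (NumberField.discr K)) (ι : K →+* ℂ)
    (P : (W.baseChange K).toAffine.Point)
    (hCM : ¬ W.HasCM) (hAddv : Addv W 3) (hGss : SubGss W 3) (hN : W.conductorNorm ℤ = N)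
    (hOpt : ∀ z ∈ Dt.L.lattice, ∃ w ∈ periodLattice Dt.f, z = Dt.c * w)
    (hOff : ¬ ((∃ (q : ℕ) (_ : Fact q.Prime), q ∣ N ∧ ¬ q ^ 2 ∣ N ∧
          padicValNat 3 W.tamagawaProduct ≤ padicValNat 3 ((W.baseChange ℚ_[q]).localTamagawaNumber ℤ_[q])) ∧
        (∀ (q' : ℕ) [Fact q'.Prime], q' ∣ N → 3 ∣ (W.baseChange ℚ_[q']).localTamagawaNumber ℤ_[q'] → ¬ q' ^ 2 ∣ N)))
    (hK : IsImaginaryQuadratic K) (hHN : SatisfiesHeegnerHypothesis N K)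
    (hP : WeierstrassCurve.Affine.Point.map ι.toRatAlgHom P = heegnerPointComplex Dt H)
    (hPinf : ¬ IsOfFinAddOrder P) (hodd : Odd (NumberField.discr K))
    (hsurj3 : W.HasSurjectiveModNGaloisRep 3) :
    padicValNat 3 W.tamagawaProduct + padicValNat 3 Dt.c.natAbs ≤ padicValNat 3 (AddSubgroup.zmultiples P).index := by
  obtain ⟨d₁⟩ := nonempty_kolyvaginHeegnerData_one_of_darmon36 (h36 _ W K) hK Dt H.β ι H.dvd_sq_sub
  obtain ⟨hP1, hrank⟩ := map_eq_derivedPoint_and_rank_of_frame (hrec _ W K) (hKo _ W K) hK hHN hP hPinf d₁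
  have h := hS W N K Dt H ι P hCM hAddv hGss hN hOpt hOff hK hHN hP hPinf hodd _ le_rfl 1 d₁
    squarefree_one (fun ℓ hℓ ↦ absurd hℓ (by simp))
  exact (pDiv_one_iff_le_padicValNat_index hK hsurj3 hrank d₁ P hP1 hPinf _).mp h

/-- **Refuted strengthening (modulo the per-row index hypothesis): Σ★″ with budget `+ 1` is FALSE** as
soon as ONE Σ★″-frame with `ρ̄_{E,3}` onto has `ord₃ [E(K):ℤP] ≤ ord₃ ∏c_ℓ(E) + v₃|c|` (`hF`; BSD-reading:
any onto row with `3 ∤ #Ш_an(E)·#Ш_an(E^{d_K})`, cf. `padicValNat_index_le_budget_of_bsdp_pair_of_not_dvd_sha`;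
exactly decidable per pair by the exact Heegner-index coefficient). The negated statement is the registered
text of `LeafSigmaStarDivisibilityAtThreeOptimalOffRows` with `padicValNat 3 Dt.c.natAbs` replaced by
`padicValNat 3 Dt.c.natAbs + 1`, everything else VERBATIM; it fails at `n = 1`, `s' = budget + 1`
(`pDiv_one_iff_le_padicValNat_index`). Target (ii) of IDEATION-BRIEF-pss3g25 §6. CONDITIONAL on `hrec`
(Shimura reciprocity at conductor `1`), `hKo` (Kolyvagin), `h36` (Darmon Thm. 3.6) and `hF`; BSD is proved
or disproved for no curve. [cite: McCallumLMS1991, §5 Lemma 5.1 (p. 303)] [cite: GrossLMS1991, §4 and Lemma 4.3] -/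
theorem leafSigmaStar_budget_succ_false_of_frame_index_le
    (hrec : ∀ (N : ℕ) [NeZero N] (W : WeierstrassCurve ℚ) (K : Type) [Field K] [NumberField K],
      heegnerPointOfConductor_one_galoisConj N W K)
    (hKo : ∀ (N : ℕ) [NeZero N] (W : WeierstrassCurve ℚ) (K : Type) [Field K] [NumberField K],
      kolyvagin N W K)
    (h36 : ∀ (N : ℕ) [NeZero N] (W : WeierstrassCurve ℚ) (K : Type) [Field K] [NumberField K],
      phi_heegnerTau_mem_range_map_singularModuliField N W K)
    (hF : ∃ (W : WeierstrassCurve ℚ) (_ : W.IsElliptic) (_ : W.IsGloballyMinimal) (N : ℕ) (_ : NeZero N) (K : Type)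
      (_ : Field K) (_ : NumberField K) (Dt : ModularParametrizationData W N) (H : HeegnerDatum N (NumberField.discr K))
      (ι : K →+* ℂ) (P : (W.baseChange K).toAffine.Point),
      ¬ W.HasCM ∧ Addv W 3 ∧ SubGss W 3 ∧ W.conductorNorm ℤ = N ∧
      (∀ z ∈ Dt.L.lattice, ∃ w ∈ periodLattice Dt.f, z = Dt.c * w) ∧
      ¬ ((∃ (q : ℕ) (_ : Fact q.Prime), q ∣ N ∧ ¬ q ^ 2 ∣ N ∧
            padicValNat 3 W.tamagawaProduct ≤ padicValNat 3 ((W.baseChange ℚ_[q]).localTamagawaNumber ℤ_[q])) ∧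
          (∀ (q' : ℕ) [Fact q'.Prime], q' ∣ N → 3 ∣ (W.baseChange ℚ_[q']).localTamagawaNumber ℤ_[q'] → ¬ q' ^ 2 ∣ N)) ∧
      IsImaginaryQuadratic K ∧ SatisfiesHeegnerHypothesis N K ∧
      (WeierstrassCurve.Affine.Point.map ι.toRatAlgHom) P = heegnerPointComplex Dt H ∧ ¬ IsOfFinAddOrder P ∧
      Odd (NumberField.discr K) ∧ W.HasSurjectiveModNGaloisRep 3 ∧
      padicValNat 3 (AddSubgroup.zmultiples P).index ≤ padicValNat 3 W.tamagawaProduct + padicValNat 3 Dt.c.natAbs) :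
    ¬ (∀ (W : WeierstrassCurve ℚ) [W.IsElliptic] [W.IsGloballyMinimal] (N : ℕ) [NeZero N] (K : Type) [Field K]
        [NumberField K] (Dt : ModularParametrizationData W N) (H : HeegnerDatum N (NumberField.discr K)) (ι : K →+* ℂ)
        (P : (W.baseChange K).toAffine.Point), ¬ W.HasCM → Addv W 3 → SubGss W 3 → W.conductorNorm ℤ = N →
        (∀ z ∈ Dt.L.lattice, ∃ w ∈ periodLattice Dt.f, z = Dt.c * w) →
        ¬ ((∃ (q : ℕ) (_ : Fact q.Prime), q ∣ N ∧ ¬ q ^ 2 ∣ N ∧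
              padicValNat 3 W.tamagawaProduct ≤ padicValNat 3 ((W.baseChange ℚ_[q]).localTamagawaNumber ℤ_[q])) ∧
            (∀ (q' : ℕ) [Fact q'.Prime], q' ∣ N → 3 ∣ (W.baseChange ℚ_[q']).localTamagawaNumber ℤ_[q'] → ¬ q' ^ 2 ∣ N)) →
        IsImaginaryQuadratic K → SatisfiesHeegnerHypothesis N K →
        (WeierstrassCurve.Affine.Point.map ι.toRatAlgHom) P = heegnerPointComplex Dt H → ¬ IsOfFinAddOrder P →
        Odd (NumberField.discr K) →
        ∀ (s' : ℕ), s' ≤ padicValNat 3 W.tamagawaProduct + (padicValNat 3 Dt.c.natAbs + 1) →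
        ∀ (n : ℕ) (d : KolyvaginHeegnerData Dt H.β ι n), Squarefree n →
        (∀ ℓ ∈ n.primeFactors, Zhang2014.IsKolyvaginPrime N W K 3 ℓ ∧ s' ≤ Zhang2014.kolyvaginIndex W 3 ℓ) →
        Three.Koly.PDiv d 3 s') := by
  intro hS
  obtain ⟨W, _, _, N, _, K, _, _, Dt, H, ι, P, hCM, hAddv, hGss, hN, hOpt, hOff, hK, hHN, hP, hPinf, hodd, hsurj3,
    hle⟩ := hF
  obtain ⟨d₁⟩ := nonempty_kolyvaginHeegnerData_one_of_darmon36 (h36 _ W K) hK Dt H.β ι H.dvd_sq_sub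
  obtain ⟨hP1, hrank⟩ := map_eq_derivedPoint_and_rank_of_frame (hrec _ W K) (hKo _ W K) hK hHN hP hPinf d₁
  have h := hS W N K Dt H ι P hCM hAddv hGss hN hOpt hOff hK hHN hP hPinf hodd
    (padicValNat 3 W.tamagawaProduct + padicValNat 3 Dt.c.natAbs + 1) (by omega) 1 d₁ squarefree_one
    (fun ℓ hℓ ↦ absurd hℓ (by simp))
  have := (pDiv_one_iff_le_padicValNat_index hK hsurj3 hrank d₁ P hP1 hPinf _).mp h
  omega

end Tight

/-! ## The per-row index hypothesis from BSD₃ of the pair (rank-one orientation) -/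

section BSD

variable {K : Type} [Field K] [NumberField K]

/-- **`BSD₃(E) ∧ BSD₃(E^{d_K}) ∧ 3 ∤ #Ш(E/K) ⟹ ord₃ [E(K):ℤP] ≤ ord₃ ∏c_ℓ(E) + v₃|c|`** (rank-one
orientation: `r_an(E) = 1`, `L(E^{d_K},1) ≠ 0`). The LOWER component of SOED's
`WildKolyvaginUpperAtThreeTight.indexBounds_of_bsdp_of_partner_bsdp` is STEP L at slack `v₃|c|`:
`2 ord₃ [E(K):ℤP] ≤ ord₃ #Ш(E/K) + 2 ord₃ ∏c_ℓ + 2 v₃|c|`; with `3 ∤ #Ш(E/K)` the `Ш`-term vanishes.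
So on such a row the hypothesis of `not_pDiv_one_succ_of_padicValNat_index_le` at `B = budget` holds and the
strengthening of Σ★″ by one FAILS at `n = 1` — BSD-conditionally; nothing asserted about any curve.
[cite: GrossZagier1986, Thm. I.(6.3) and V.(2.2)] [cite: JetchevSkinnerWan2017, §7.4.1] -/
theorem padicValNat_index_le_budget_of_bsdp_pair_of_not_dvd_sha
    (hGZ : ∀ (N : ℕ) [NeZero N] (W : WeierstrassCurve ℚ) (K : Type) [Field K] [NumberField K],
      gross_zagier N W K)
    (hKo : ∀ (N : ℕ) [NeZero N] (W : WeierstrassCurve ℚ) (K : Type) [Field K] [NumberField K],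
      kolyvagin N W K)
    (hGZK : rank_eq_analyticRank_of_analyticRank_le_one) (hmod : hasEntireLFunction_rat)
    (hGZ73 : GrossZagier1986_thm_I_7_3)
    (W : WeierstrassCurve ℚ) [W.IsElliptic] [W.IsGloballyMinimal] (N : ℕ) [NeZero N]
    (Dt : ModularParametrizationData W N) (H : HeegnerDatum N (NumberField.discr K)) (ι : K →+* ℂ)
    (P : (W.baseChange K).toAffine.Point) (Wd : WeierstrassCurve ℚ) [Wd.IsElliptic] [Wd.IsGloballyMinimal]
    (hr : W.analyticRank = 1) (hN : W.conductorNorm ℤ = N) (h3N : 3 ∣ N) (hK : IsImaginaryQuadratic K)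
    (hodd : Odd (NumberField.discr K)) (hHN : SatisfiesHeegnerHypothesis N K)
    (hLt : (W.quadraticTwist (NumberField.discr K : ℚ)).entireLFunction 1 ≠ 0)
    (hP : WeierstrassCurve.Affine.Point.map ι.toRatAlgHom P = heegnerPointComplex Dt H)
    (hC : ∃ C : VariableChange ℚ, C • W.quadraticTwist (NumberField.discr K : ℚ) = Wd)
    (hBW : BSDp W 3) (hBWd : BSDp Wd 3) (hSha : ¬ 3 ∣ (W.baseChange K).shaOrder) :
    padicValNat 3 (AddSubgroup.zmultiples P).index ≤ padicValNat 3 W.tamagawaProduct + padicValNat 3 Dt.c.natAbs := by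
  haveI : Fact (Nat.Prime 3) := ⟨Nat.prime_three⟩
  have hp2 : (3 : ℕ) ≠ 2 := by decide
  subst hN
  obtain ⟨-, hμ⟩ := X11b.Three.not_dvd_discr_and_not_dvd_torsionOrder_of_heegner hK hHN hp2 h3N
  obtain ⟨hlow, -⟩ := WildKolyvaginUpperAtThreeTight.indexBounds_of_bsdp_of_partner_bsdp hGZ hKo hGZK hmod hGZ73 W 3
    (W.conductorNorm ℤ) K Dt H ι P Wd hr rfl h3N hK hodd hμ hHN hLt hP hC hp2 hBW hBWd
  unfold SchneiderFree.IndexLowerBoundLeAt at hlow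
  have h0 : padicValNat 3 (W.baseChange K).shaOrder = 0 := padicValNat.eq_zero_of_not_dvd hSha
  omega

/-- **Exact `n = 1` picture under BSD₃ of the pair (tower onto, rank-one orientation):**
`PDiv d₁ 3 s' ↔ 2 s' ≤ ord₃ #Ш(E/K) + 2 ord₃ ∏c_ℓ(E) + 2 v₃|c|`. Both components of
`indexBounds_of_bsdp_of_partner_bsdp` give `2 ord₃ [E(K):ℤP] = ord₃ #Ш(E/K) + 2 ord₃∏c_ℓ + 2 v₃|c|`, and
`pDiv_one_iff_le_padicValNat_index` converts. Consequences (BSD-reading, onto rows): Σ★″ at `n = 1` asks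
exactly `ord₃ #Ш(E/K) ≥ 0` — no content beyond BSD; its strengthening by one at `n = 1` holds iff
`9 ∣ #Ш(E/K)` (`Ш` has square order) — so «budget + 1» is FALSE on every onto row with `Ш(E/K)[3] = 0`
and TRUE at `n = 1` on rows with `3 ∣ #Ш(E/K)`: the registered budget is the largest ROW-UNIFORM one.
CONDITIONAL on the named facts and the two `BSDp`'s; nothing asserted about any curve.
[cite: McCallumLMS1991, §5 Lemma 5.1 (p. 303)] [cite: GrossZagier1986, V.(2.2)] -/
theorem pDiv_one_iff_of_bsdp_pair
    (hGZ : ∀ (N : ℕ) [NeZero N] (W : WeierstrassCurve ℚ) (K : Type) [Field K] [NumberField K],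
      gross_zagier N W K)
    (hKo : ∀ (N : ℕ) [NeZero N] (W : WeierstrassCurve ℚ) (K : Type) [Field K] [NumberField K],
      kolyvagin N W K)
    (hGZK : rank_eq_analyticRank_of_analyticRank_le_one) (hmod : hasEntireLFunction_rat)
    (hGZ73 : GrossZagier1986_thm_I_7_3)
    (hrec : ∀ (N : ℕ) [NeZero N] (W : WeierstrassCurve ℚ) (K : Type) [Field K] [NumberField K],
      heegnerPointOfConductor_one_galoisConj N W K)
    (W : WeierstrassCurve ℚ) [W.IsElliptic] [W.IsGloballyMinimal] (N : ℕ) [NeZero N]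
    (Dt : ModularParametrizationData W N) (H : HeegnerDatum N (NumberField.discr K)) (ι : K →+* ℂ)
    (P : (W.baseChange K).toAffine.Point) (Wd : WeierstrassCurve ℚ) [Wd.IsElliptic] [Wd.IsGloballyMinimal]
    (hr : W.analyticRank = 1) (hN : W.conductorNorm ℤ = N) (h3N : 3 ∣ N)
    (hsurj3 : W.HasSurjectiveModNGaloisRep 3) (hK : IsImaginaryQuadratic K)
    (hodd : Odd (NumberField.discr K)) (hHN : SatisfiesHeegnerHypothesis N K)
    (hLt : (W.quadraticTwist (NumberField.discr K : ℚ)).entireLFunction 1 ≠ 0)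
    (hP : WeierstrassCurve.Affine.Point.map ι.toRatAlgHom P = heegnerPointComplex Dt H)
    (hC : ∃ C : VariableChange ℚ, C • W.quadraticTwist (NumberField.discr K : ℚ) = Wd)
    (hBW : BSDp W 3) (hBWd : BSDp Wd 3) (d₁ : KolyvaginHeegnerData Dt H.β ι 1) (s' : ℕ) :
    Three.Koly.PDiv d₁ 3 s' ↔
      2 * s' ≤ padicValNat 3 (W.baseChange K).shaOrder + 2 * padicValNat 3 W.tamagawaProduct +
        2 * padicValNat 3 Dt.c.natAbs := by
  haveI : Fact (Nat.Prime 3) := ⟨Nat.prime_three⟩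
  have hp2 : (3 : ℕ) ≠ 2 := by decide
  subst hN
  obtain ⟨-, hμ⟩ := X11b.Three.not_dvd_discr_and_not_dvd_torsionOrder_of_heegner hK hHN hp2 h3N
  have hPinf : ¬ IsOfFinAddOrder P :=
    not_isOfFinAddOrder_of_heegner_of_analyticRank_eq_one W (W.conductorNorm ℤ) K Dt H ι P (hGZ _ W K) hmod hr hK
      hHN hLt hP
  obtain ⟨hP1, hrank⟩ := map_eq_derivedPoint_and_rank_of_frame (hrec _ W K) (hKo _ W K) hK hHN hP hPinf d₁
  obtain ⟨hlow, hup⟩ := WildKolyvaginUpperAtThreeTight.indexBounds_of_bsdp_of_partner_bsdp hGZ hKo hGZK hmod hGZ73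
    W 3 (W.conductorNorm ℤ) K Dt H ι P Wd hr rfl h3N hK hodd hμ hHN hLt hP hC hp2 hBW hBWd
  unfold SchneiderFree.IndexLowerBoundLeAt at hlow
  unfold SchneiderFree.Upper.IndexUpperBoundLeAt at hup
  rw [pDiv_one_iff_le_padicValNat_index hK hsurj3 hrank d₁ P hP1 hPinf]
  omega

end BSD

end Summit.BirchSwinnertonDyer.BirchSwinnertonDyer.Theorems.LeafSigmaStarDivisibilityAtThreeOptimalOffRowsNegative

end
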